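import Summits.AtomisticToContinuum.Crystallization.Theorems.PricedLinkCensusTruncatedCensusGapChargeLocality

/-!
# Under-coordination locality: the bond count of a site only sees the sites within `2(1+η)·nn` of it

Helper (U-LOCALITY) for the stub `stub_underCoordinationGap` (class (U) of the census split
`Cruxes/TruncatedCensusGap/Lines/birth.lean`) of the crux `PricedLinkCensus.TruncatedCensusGap`
(item stmt-AtomisticToContinuum-14230).  It is the bond-count analogue of the landed CHARGE
LOCALITY `isChargeFree_sub_iff` / `isChargeFree_comp_embedding_iff`
(`Theorems/PricedLinkCensusTruncatedCensusGapChargeLocality.lean`), whose proof already contains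
the neighbour-set correspondence under an embedding; here that correspondence is extracted as a
statement of its own.

In the SCALE-FREE bond graph `bondGraph η y` (`j ∼ k ↔ j ≠ k ∧ dist ≤ (1+η)·min (nn_j) (nn_k)`,
`Literature/Geometry/DiscreteGeometry/BondGraph.lean`), the neighbour set of the site `f i` of a
finite configuration `y` is the `f`-image of the neighbour set of `i` in the sub-configuration
`y ∘ f` (`f : κ ↪ ι` an embedding of indices), as soon as the range of `f` contains every site
within `2(1+η)·nn_{f i}` of `y (f i)` (`0 ≤ η`).  Hence the NUMBER OF BONDS of `f i` — and in
particular whether `f i` is under-coordinated (`< 12` bonds), twelve-coordinated or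
over-coordinated — is decided by the configuration within `2(1+η)·nn_{f i}` of it.  This is the
locality input for reading the under-coordination count of class (U) in blocks and in
periodisations (the `U`-twin of `Blocks.isChargeFree_block_iff` / `isChargeFree_toPoint_iff`).

## Proof layout (general index types, `[Finite ι]`, any pseudo-metric space)

* (a) a nearest neighbour of `f i` lies within `nn ≤ 2(1+η)·nn` of it, hence in the range, so
  `nn_{y∘f}(i) = nn_y(f i)` (`nearestDist_comp_eq_of_attained`);
* (b) every site `f a` within `(1+η)·nn_{f i}` of `y (f i)` has a nearest neighbour within
  `nn_{f a} + (1+η)·nn_{f i} ≤ 2(1+η)·nn_{f i}` of `y (f i)`, hence in the range, so its scale is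
  unchanged too;
* (c) therefore `f i ∼ f a` in `y` iff `i ∼ a` in `y ∘ f`, and every bond-neighbour of `f i` in
  `y` lies in the range of `f`: `N_y(f i) = f '' N_{y∘f}(i)` (`neighborSet_apply_eq_image_comp`);
* `f` is injective, so the cardinalities agree (`ncard_neighborSet_apply_eq_comp`); the
  registered `Fin`-indexed forms are `ncard_neighborSet_sub_eq` and `underCoordinated_sub_iff`.
-/

noncomputable section

namespace Summit.AtomisticToContinuum.Crystallization.Theorems.PricedLinkCensusTruncatedCensusGap

open Literature.MathematicalPhysics.StatisticalMechanics Literature.Geometry.DiscreteGeometry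

section UnderCoordinationLocality

variable {ι κ X : Type*} [PseudoMetricSpace X] [Finite ι]

/-- **Neighbour-set locality (embedding form).**  Let `0 ≤ η`, let `y : ι → X` be a finite
configuration and `f : κ ↪ ι` a sub-family whose range contains every site within
`2(1+η)·nn_{f i}` of `y (f i)`.  Then the bond-neighbours of `f i` in `y` are exactly the
`f`-images of the bond-neighbours of `i` in the sub-configuration `y ∘ f`. [folklore] -/
theorem neighborSet_apply_eq_image_comp {η : ℝ} (hη : 0 ≤ η) (y : ι → X) (f : κ ↪ ι) (i : κ)
    (hS : ∀ k, dist (y k) (y (f i)) ≤ 2 * (1 + η) * nearestDist y (f i) → k ∈ Set.range f) :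
    (bondGraph η y).neighborSet (f i) = f '' (bondGraph η (y ∘ f)).neighborSet i := by
  have hη1 : (0 : ℝ) ≤ 1 + η := by linarith
  have hnn : 0 ≤ nearestDist y (f i) := nearestDist_nonneg y (f i)
  by_cases hN : ∃ k, k ≠ f i
  swap
  · -- a single site: both neighbour sets are empty
    push Not at hN
    ext k
    simp only [SimpleGraph.mem_neighborSet, Set.mem_image]
    constructor
    · intro hk
      exact absurd (hN k).symm (bondGraph_adj.1 hk).1
    · rintro ⟨a, ha, rfl⟩
      exact absurd (f.injective (hN (f a))).symm (bondGraph_adj.1 ha).1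
  -- (a) a nearest neighbour of `f i` lies in the range, so the scale of `i` is unchanged
  have hnn_i : nearestDist (y ∘ f) i = nearestDist y (f i) := by
    obtain ⟨m, hm, hdm⟩ := exists_nearestDist_eq_dist y hN
    have hmS : m ∈ Set.range f := by
      refine hS m ?_
      rw [dist_comm, ← hdm]
      exact le_mul_of_one_le_left hnn (by linarith)
    obtain ⟨b, rfl⟩ := hmS
    exact nearestDist_comp_eq_of_attained y f (f.injective.ne_iff.1 hm) hdm
  -- (b) sites within `(1+η)·nn` of `y (f i)` are in the range, with unchanged scales
  have hball : ∀ k, dist (y (f i)) (y k) ≤ (1 + η) * nearestDist y (f i) → k ∈ Set.range f := by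
    intro k hk
    refine hS k ?_
    rw [dist_comm]
    have h0 : 0 ≤ (1 + η) * nearestDist y (f i) := mul_nonneg hη1 hnn
    linarith
  have hnn_eq : ∀ a : κ, dist (y (f i)) (y (f a)) ≤ (1 + η) * nearestDist y (f i) →
      nearestDist (y ∘ f) a = nearestDist y (f a) := by
    intro a ha
    by_cases hai : a = i
    · rw [hai]
      exact hnn_i
    have hia : f i ≠ f a := f.injective.ne (Ne.symm hai)
    obtain ⟨m, hm, hdm⟩ := exists_nearestDist_eq_dist y ⟨f i, hia⟩
    have hmS : m ∈ Set.range f := by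
      refine hS m ?_
      have h1 : nearestDist y (f a) ≤ dist (y (f a)) (y (f i)) := nearestDist_le_dist y hia
      have h2 : dist (y (f i)) (y (f a)) = dist (y (f a)) (y (f i)) := dist_comm _ _
      calc dist (y m) (y (f i)) ≤ dist (y m) (y (f a)) + dist (y (f a)) (y (f i)) :=
            dist_triangle _ _ _
        _ = nearestDist y (f a) + dist (y (f a)) (y (f i)) := by
            rw [hdm, dist_comm (y m) (y (f a))]
        _ ≤ (1 + η) * nearestDist y (f i) + (1 + η) * nearestDist y (f i) := by linarith
        _ = 2 * (1 + η) * nearestDist y (f i) := by ring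
    obtain ⟨b, rfl⟩ := hmS
    exact nearestDist_comp_eq_of_attained y f (f.injective.ne_iff.1 hm) hdm
  -- (c) the bonds at `f i` are the same in `y` and in `y ∘ f`
  have hadj_i : ∀ a : κ, (bondGraph η y).Adj (f i) (f a) ↔ (bondGraph η (y ∘ f)).Adj i a := by
    intro a
    rw [bondGraph_adj, bondGraph_adj]
    constructor
    · rintro ⟨hne, hle⟩
      have hd : dist (y (f i)) (y (f a)) ≤ (1 + η) * nearestDist y (f i) :=
        hle.trans (mul_le_mul_of_nonneg_left (min_le_left _ _) hη1)
      refine ⟨f.injective.ne_iff.1 hne, ?_⟩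
      show dist (y (f i)) (y (f a)) ≤ (1 + η) * min (nearestDist (y ∘ f) i) (nearestDist (y ∘ f) a)
      rw [hnn_i, hnn_eq a hd]
      exact hle
    · rintro ⟨hne, hle⟩
      change dist (y (f i)) (y (f a)) ≤
        (1 + η) * min (nearestDist (y ∘ f) i) (nearestDist (y ∘ f) a) at hle
      rw [hnn_i] at hle
      have hd : dist (y (f i)) (y (f a)) ≤ (1 + η) * nearestDist y (f i) :=
        hle.trans (mul_le_mul_of_nonneg_left (min_le_left _ _) hη1)
      rw [hnn_eq a hd] at hle
      exact ⟨f.injective.ne hne, hle⟩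
  -- every bond at `f i` lands in the range
  have hmem : ∀ k, (bondGraph η y).Adj (f i) k → k ∈ Set.range f := fun k hk =>
    hball k ((bondGraph_adj.1 hk).2.trans (mul_le_mul_of_nonneg_left (min_le_left _ _) hη1))
  -- assemble
  ext k
  simp only [SimpleGraph.mem_neighborSet, Set.mem_image]
  constructor
  · intro hk
    obtain ⟨a, rfl⟩ := hmem k hk
    exact ⟨a, (hadj_i a).1 hk, rfl⟩
  · rintro ⟨a, ha, rfl⟩
    exact (hadj_i a).2 ha

/-- **Bond-count locality (embedding form).**  Under the hypotheses of
`neighborSet_apply_eq_image_comp`, the site `f i` has as many bonds in `y` as `i` has in the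
sub-configuration `y ∘ f` (`f` is injective). [folklore] -/
theorem ncard_neighborSet_apply_eq_comp {η : ℝ} (hη : 0 ≤ η) (y : ι → X) (f : κ ↪ ι) (i : κ)
    (hS : ∀ k, dist (y k) (y (f i)) ≤ 2 * (1 + η) * nearestDist y (f i) → k ∈ Set.range f) :
    ((bondGraph η y).neighborSet (f i)).ncard = ((bondGraph η (y ∘ f)).neighborSet i).ncard := by
  rw [neighborSet_apply_eq_image_comp hη y f i hS, Set.ncard_image_of_injective _ f.injective]

/-- **Under-coordination locality (embedding form).**  Under the same hypotheses, `f i` has fewer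
than `b` bonds in `y` iff `i` has fewer than `b` bonds in `y ∘ f` (class (U) of the census split
uses `b = 12`). [folklore] -/
theorem ncard_neighborSet_apply_lt_iff_comp {η : ℝ} (hη : 0 ≤ η) (y : ι → X) (f : κ ↪ ι)
    (i : κ) (b : ℕ)
    (hS : ∀ k, dist (y k) (y (f i)) ≤ 2 * (1 + η) * nearestDist y (f i) → k ∈ Set.range f) :
    ((bondGraph η y).neighborSet (f i)).ncard < b ↔
      ((bondGraph η (y ∘ f)).neighborSet i).ncard < b := by
  rw [ncard_neighborSet_apply_eq_comp hη y f i hS]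

end UnderCoordinationLocality

/-- **Bond-count locality** (registered `Fin`-indexed form, the `U`-analogue of
`isChargeFree_sub_iff`): for `0 ≤ η` and a sub-configuration `y ∘ f` (`f : Fin M ↪ Fin N`) of a
finite configuration `y : Fin N → ℝ³` whose range contains every site within `2(1+η)·nn_{f i}` of
`y (f i)`, the site `f i` has in `y` exactly as many bonds as `i` has in `y ∘ f`. [folklore] -/
theorem ncard_neighborSet_sub_eq :
    ∀ (η : ℝ), 0 ≤ η → ∀ (N M : ℕ) (y : Fin N → EuclideanSpace ℝ (Fin 3)) (f : Fin M ↪ Fin N)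
      (i : Fin M), (∀ k : Fin N, dist (y k) (y (f i)) ≤
        2 * (1 + η) * Literature.Geometry.DiscreteGeometry.nearestDist y (f i) → k ∈ Set.range f) →
      ((Literature.Geometry.DiscreteGeometry.bondGraph η y).neighborSet (f i)).ncard =
        ((Literature.Geometry.DiscreteGeometry.bondGraph η (y ∘ f)).neighborSet i).ncard := by
  intro η hη N M y f i hS
  exact ncard_neighborSet_apply_eq_comp hη y f i hS

/-- **Under-coordination locality** (registered `Fin`-indexed form at the route's tolerance
`1/100`): with every site within `2·(1 + 1/100)·nn_{f i}` of `y (f i)` in the range of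
`f : Fin M ↪ Fin N`, the site `f i` is under-coordinated in `y` (fewer than twelve bonds in the
scale-free bond graph) iff `i` is under-coordinated in `y ∘ f`. [folklore] -/
theorem underCoordinated_sub_iff :
    ∀ (N M : ℕ) (y : Fin N → EuclideanSpace ℝ (Fin 3)) (f : Fin M ↪ Fin N) (i : Fin M),
      (∀ k : Fin N, dist (y k) (y (f i)) ≤ 2 * (1 + (1 / 100 : ℝ)) * nearestDist y (f i) →
        k ∈ Set.range f) →
      (((bondGraph (1 / 100 : ℝ) y).neighborSet (f i)).ncard < 12 ↔
        ((bondGraph (1 / 100 : ℝ) (y ∘ f)).neighborSet i).ncard < 12) := by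
  intro N M y f i hS
  exact ncard_neighborSet_apply_lt_iff_comp (by norm_num) y f i 12 hS

end Summit.AtomisticToContinuum.Crystallization.Theorems.PricedLinkCensusTruncatedCensusGap

end
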